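import Literature.MathematicalPhysics.QuantumFieldTheory.Balaban1983to89.B9Thm313WholeRgdFrom3152
import Literature.MathematicalPhysics.QuantumFieldTheory.Balaban1983to89.B9Thm313WholeDvFromDds

/-!
# `Balaban1983to89.B9Thm313WholeRgdSecondFrom3152` — [B9] Theorem 3.13 (pp. 424–426): THE SECOND-ORDER `RD*G₁`-LETTERS OF ROWS 20–21 (`rgdDs` = R∘D\*∘G₁∘∇\*_U,
# `rgdDd μ₀` = R∘D\*∘G₁∘∇\*_{U,μ₀} in block L²) FROM THE PRINTED IDENTITY (3.152), (3.49) AND A BLOCK-L² LINE OF G′D\*∘E — plus the block-L² algebra of a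
# slot-decomposed word `s • Σ_ν Π_ν ∘ Σ_μ C_μ ∘ A_{μν} ∘ E_{μν}` (the form rows 18's per-direction-pair second-order lines of G′ take after the kinematics)

T. Bałaban, *Propagators for lattice gauge theories in a background field*, Commun. Math. Phys. **99** (1985) 389–434
[`Balaban1985BackgroundPropagators`, "B9"]; [4] = T. Bałaban, *Propagators and renormalization transformations for lattice gauge
theories. II*, Commun. Math. Phys. **96** (1984) 223–250 [`Balaban1984PropagatorsII`].

statement-level skeleton of published theorems with citation tags; proofs where landed; nothing here is a claim about the Yang–Mills mass gap

THE PRINTED LOCUS (held text `paper:balaban1985-cmp99-background-propagators`).  (3.152)–(3.153) p. 426: *"𝔊 = G₁ − G₁DRD\*G₁ − …"* with *"RD\*G₁ = RG′D\*"*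
(the R-words of H₁∕𝔊 are words of G′); Theorem 3.1 (3.46) p. 398 (the block-L² lines of G′ incl. the second-order ones, *"max_{μ,ν}"* (3.39) p. 397); (3.49) p. 399
(P = I − ϱ⁻¹R exponentially localised); [4] (2.51)–(2.56) pp. 232–233 (composition ∕ sums of exponentially decaying block kernels, one row sum per composition).

WHY THIS FILE (cell `pub-ymgap`, node N06 [B9], rows 20–21; seat `pub-ymgap-dag-n06-c` g21).  dag-n06-l g16's `B9Thm313WholeRgdFrom3152.rgdI_of_ids3152` turned the
displayed `Letters313L2P*.rgdI` (R∘D\*∘G₁) into a theorem of rows 18's Theorem 3.1 majorant for G′D\* + (3.49) + (3.152); its docstring lists `rgdDs ∕ rgdDd` as the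
SECOND-ORDER members the bundled `Thm31GpMaj` does not carry.  Rows 18 DO carry them, per direction pair: `L2SecondLegs37` ∕ `l2line5_left_pairM` give
‖1_{Δ(y)}G′∇\*_{U,μ}∇\*_{U,ν}‖ in block L²; and `B9DivGradStarKinematicsAtPins` writes G′∘D\*_U∘∇\*_U (resp. ∘∇\*_{U,μ₀}) at node00-def-Y's letters as
`(c_fη)² • Σ_ν Π_ν ∘ Σ_μ slotCopy_μ ∘ (G′∇\*_μ∇\*_ν) ∘ dirSliceK μ ν` with block-L² letters for Π_ν, slotCopy_μ, dirSliceK μ ν.  THIS FILE is the carrier-free algebra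
between: §0 compositions with ONE row sum (`blockBd_comp_exp ∕ _mirror`), scalars, differences, constant sums at the `BlockBd` level; §1 ★★ `blockBd_slotWord` — the
block-L² line of any word `s • Σ_ν Pr ν ∘ Σ_μ Cp μ ∘ A μ ν ∘ E μ ν` from block-L² lines of the four letter families (A at rate δ_A, the kinematic ones at a rate
δ_K with margin σ above the target rate; three row sums); §2 ★★ `rgdE_of_ids3152` — for ANY right factor E: ‖1_{Δ(y)}R∇\*_UG₁Eμ‖₂ from a block-L² line of G′D\*E
(`hX`), (3.49) (`blockBd_P`), R = ϱ•(I − P) and (3.152) (`Ids3152.rd`), exactly as `rgdI_of_ids3152` does for E = id (one composition with P at margin σ, one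
difference, one scalar).  At E = ∇\*_U this is `Letters313L2Pk.rgdDs`, at E = ∇\*_{U,μ₀} it is `Letters313L2MZ.rgdDd μ₀`; the member-uniform package at the
certificate's pins is `Summits/…/BalabanUVNodesN06RgdDsLegAtPinsPhysR`.

HONEST SCOPE.  Kernel bookkeeping over landed modules; the block-L² inputs are HYPOTHESES of printed shape; (3.152) is NOT proved here (displayed identity `Ids3152`);
nothing of print's estimates asserted; COUNT-NEUTRAL; N06 NOT discharged; one finite lattice at a time; nothing continuum, nothing about the mass gap.  A NEW file;
0 `def`, no `sorry`, no `axiom`, no `instance`, no `notation`.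
-/

namespace Literature.MathematicalPhysics.QuantumFieldTheory.Balaban1983to89.B9Thm313WholeRgdSecondFrom3152

open Literature.MathematicalPhysics.QuantumFieldTheory.Balaban1983to89
open Finset B6RandomWalk B6RandomWalkHom B9Thm34Ext B11SectG B9SectDSup B9SectDL2Decay B9Thm37Glue B9Thm312Whole
open B9Thm312WholeClasses B9RWSums343to347Whole B9RWSums346Schur B9PerturbationMajorantAlgebra B9PerturbationMajorantLetters
open B9Thm313WholeRgdFrom3152 B9Thm313WholeDvFromDds

noncomputable section

variable {g : B9.Geometry} {B : B9.Backgrounds} {X Y Z W : Type} [Fintype X] [Fintype W] [Fintype g.Site]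
variable {R₀ : ℝ} {H₀ : Prop}

/-! ## §0 Block-L² algebra: compositions with one row sum, scalars, differences, constant sums -/

section Algebra

variable {X₁ X₂ X₃ : Type} [Fintype X₁] [Fintype X₂] [Fintype X₃]

omit [Fintype X] [Fintype W] in
/-- **COMPOSITION OF TWO (3.46)-LINES WITH ONE ROW SUM** (left factor at a rate `ρ₁ ≥ ρ + σ`, right factor at `ρ₂ ≥ ρ`): constants multiply, times the row-sum
constant `c` of `RowSum σ c`. [cite: Balaban1984PropagatorsII, (2.52)–(2.56) pp.232–233; Balaban1985BackgroundPropagators, (3.46) p.398 (bookkeeping)] -/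
theorem blockBd_comp_exp (hG : GeoOK g) {σ c : ℝ} (hrow : RowSum (toB6 g R₀ H₀) σ c) {blk₁ : X₁ → g.Site} {blk₂ : X₂ → g.Site} {blk₃ : X₃ → g.Site}
    {T₁ : (X₂ → ℝ) →ₗ[ℝ] (X₃ → ℝ)} {T₂ : (X₁ → ℝ) →ₗ[ℝ] (X₂ → ℝ)} {a₁ a₂ ρ₁ ρ₂ ρ : ℝ}
    (ha₁ : 0 ≤ a₁) (ha₂ : 0 ≤ a₂) (hρ : 0 ≤ ρ) (hρ₂ : ρ ≤ ρ₂) (hρ₁ : ρ + σ ≤ ρ₁)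
    (h₁ : BlockBd (g := toB6 g R₀ H₀) blk₂ blk₃ T₁ (fun (y y' : g.Site) => a₁ * Real.exp (-(ρ₁ * g.dist y y'))))
    (h₂ : BlockBd (g := toB6 g R₀ H₀) blk₁ blk₂ T₂ (fun (y y' : g.Site) => a₂ * Real.exp (-(ρ₂ * g.dist y y')))) :
    BlockBd (g := toB6 g R₀ H₀) blk₁ blk₃ (T₁ ∘ₗ T₂) (fun (y y' : g.Site) => a₁ * a₂ * c * Real.exp (-(ρ * g.dist y y'))) := by
  have htri : Triangle254 (toB6 g R₀ H₀) := fun a b c => hG.tri a b c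
  rw [blockBd_iff_hasMaj] at h₁ h₂ ⊢
  refine (hasMaj_comp_exp htri hG.dnn hrow ha₁ ha₂ hρ hρ₂ hρ₁ h₁ h₂).mono fun a b => le_of_eq ?_
  simp only [l2w_κ, toB6_dist]
  ring

omit [Fintype X] [Fintype W] in
/-- **COMPOSITION, MIRRORED MARGINS** (left factor at `ρ₁ ≥ ρ`, right factor at `ρ₂ ≥ ρ + σ`). [cite: Balaban1984PropagatorsII, (2.52)–(2.56) pp.232–233 (bookkeeping)] -/
theorem blockBd_comp_exp_mirror (hG : GeoOK g) {σ c : ℝ} (hrow : RowSum (toB6 g R₀ H₀) σ c) {blk₁ : X₁ → g.Site} {blk₂ : X₂ → g.Site}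
    {blk₃ : X₃ → g.Site} {T₁ : (X₂ → ℝ) →ₗ[ℝ] (X₃ → ℝ)} {T₂ : (X₁ → ℝ) →ₗ[ℝ] (X₂ → ℝ)} {a₁ a₂ ρ₁ ρ₂ ρ : ℝ}
    (ha₁ : 0 ≤ a₁) (ha₂ : 0 ≤ a₂) (hρ : 0 ≤ ρ) (hρ₁ : ρ ≤ ρ₁) (hρ₂ : ρ + σ ≤ ρ₂)
    (h₁ : BlockBd (g := toB6 g R₀ H₀) blk₂ blk₃ T₁ (fun (y y' : g.Site) => a₁ * Real.exp (-(ρ₁ * g.dist y y'))))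
    (h₂ : BlockBd (g := toB6 g R₀ H₀) blk₁ blk₂ T₂ (fun (y y' : g.Site) => a₂ * Real.exp (-(ρ₂ * g.dist y y')))) :
    BlockBd (g := toB6 g R₀ H₀) blk₁ blk₃ (T₁ ∘ₗ T₂) (fun (y y' : g.Site) => a₁ * a₂ * c * Real.exp (-(ρ * g.dist y y'))) := by
  have htri : Triangle254 (toB6 g R₀ H₀) := fun a b c => hG.tri a b c
  have hsym : DistSymm (toB6 g R₀ H₀) := fun a b => hG.symm a b
  rw [blockBd_iff_hasMaj] at h₁ h₂ ⊢
  refine (hasMaj_comp_exp_mirror hsym htri hG.dnn hrow ha₁ ha₂ hρ hρ₁ hρ₂ h₁ h₂).mono fun a b => le_of_eq ?_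
  simp only [l2w_κ, toB6_dist]
  ring

omit [Fintype X] [Fintype W] in
/-- **SCALARS**: `BlockBd T N ⇒ BlockBd (s • T) (|s|·N)`. [cite: Balaban1985BackgroundPropagators, (3.46) p.398 (bookkeeping)] -/
theorem blockBd_smul_abs {blk₁ : X₁ → g.Site} {blk₂ : X₂ → g.Site} {T : (X₁ → ℝ) →ₗ[ℝ] (X₂ → ℝ)} {N : g.Site → g.Site → ℝ}
    (h : BlockBd (g := toB6 g R₀ H₀) blk₁ blk₂ T N) (s : ℝ) : BlockBd (g := toB6 g R₀ H₀) blk₁ blk₂ (s • T) (fun y y' => |s| * N y y') := by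
  intro y' μ hμ y
  rw [LinearMap.smul_apply, bl2_smul, mul_assoc]
  exact mul_le_mul_of_nonneg_left (h y' μ hμ y) (abs_nonneg s)

omit [Fintype X] [Fintype W] in
/-- **DIFFERENCES**: kernels add. [cite: Balaban1984PropagatorsII, p.232 («a summation preserves it also»), bookkeeping] -/
theorem blockBd_sub {blk₁ : X₁ → g.Site} {blk₂ : X₂ → g.Site} {T₁ T₂ : (X₁ → ℝ) →ₗ[ℝ] (X₂ → ℝ)} {N₁ N₂ : g.Site → g.Site → ℝ}
    (h₁ : BlockBd (g := toB6 g R₀ H₀) blk₁ blk₂ T₁ N₁) (h₂ : BlockBd (g := toB6 g R₀ H₀) blk₁ blk₂ T₂ N₂) :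
    BlockBd (g := toB6 g R₀ H₀) blk₁ blk₂ (T₁ - T₂) (fun y y' => N₁ y y' + N₂ y y') := by
  rw [blockBd_iff_hasMaj] at h₁ h₂ ⊢
  exact h₁.sub h₂

/-- **FINITE SUMS WITH ONE COMMON KERNEL**: the kernel times the number of summands. [cite: Balaban1984PropagatorsII, (2.52) p.232 (bookkeeping)] -/
theorem blockBd_fsum_const {ι : Type} [Fintype ι] {blk₁ : W → g.Site} {blk₂ : X → g.Site} (T : ι → (W → ℝ) →ₗ[ℝ] (X → ℝ))
    (N : g.Site → g.Site → ℝ) (h : ∀ i, BlockBd (g := toB6 g R₀ H₀) blk₁ blk₂ (T i) N) :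
    BlockBd (g := toB6 g R₀ H₀) blk₁ blk₂ (∑ i, T i) (fun (y y' : g.Site) => (Fintype.card ι : ℝ) * N y y') :=
  (blockBd_fsum (g := g) (R₀ := R₀) (H₀ := H₀) Finset.univ T (fun _ => N) fun i _ => h i).mono fun y y' =>
    by rw [Finset.sum_const, Finset.card_univ, nsmul_eq_mul]

end Algebra

/-! ## §1 The block-L² line of a slot-decomposed word -/

/-- ★★ **THE BLOCK-L² LINE OF A SLOT-DECOMPOSED WORD** `T = s • Σ_ν Pr ν ∘ Σ_μ Cp μ ∘ A μ ν ∘ E μ ν` (the shape of G′∘D\*_U∘∇\*_U at node00-def-Y's letters,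
`B9DivGradStarKinematicsAtPins.GcoS_DvscoKH_DscoK_eq`: Pr = slice projections, Cp = slot copies, A μ ν = G′∇\*_{U,μ}∇\*_{U,ν}, E μ ν = direction slices): from
‖1_{Δ}A μ ν‖ ≦ C_A e^{−δ_A d} (rows 18's second-order line, (3.46)) and the kinematic letters ‖1_{Δ}E μ ν‖ ≦ C_E e^{−δ_K d}, ‖1_{Δ}Cp μ‖ ≦ C_C e^{−δ_K d},
‖1_{Δ}Pr ν‖ ≦ C_Q e^{−δ_K d} with `δ_K ≥ ρ + σ`, `δ_A ≥ ρ ≥ 0` and a row sum `RowSum σ c` (`c ≥ 0`): ‖1_{Δ(y)}Tλ‖₂ ≦ B·e^{−ρd(y,y′)}‖λ‖₂ for every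
`B ≥ |s|·|P|·C_Q·(|P|·C_C·(C_A C_E c)·c)·c` (three compositions, two sums over the direction index `P`).
[cite: Balaban1985BackgroundPropagators, Thm 3.1 (3.46) p.398 + (3.39) p.397 («max_{μ,ν}»); Balaban1984PropagatorsII, (2.51)–(2.56) pp.232–233] -/
theorem blockBd_slotWord (hG : GeoOK g) {σ c : ℝ} (hrow : RowSum (toB6 g R₀ H₀) σ c) {P : Type} [Fintype P]
    {blkB : W → g.Site} {blkS : X → g.Site} {T : (W → ℝ) →ₗ[ℝ] (X → ℝ)}
    {A : P → P → Module.End ℝ (X → ℝ)} {E : P → P → (W → ℝ) →ₗ[ℝ] (X → ℝ)} {Cp Pr : P → Module.End ℝ (X → ℝ)}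
    {s CA δA CE CC CQ δK ρ Bd : ℝ}
    (hT : T = s • ∑ ν, Pr ν ∘ₗ ∑ μ, Cp μ ∘ₗ (A μ ν ∘ₗ E μ ν))
    (hA : ∀ μ ν, BlockBd (g := toB6 g R₀ H₀) blkS blkS (A μ ν) (fun (y y' : g.Site) => CA * Real.exp (-(δA * g.dist y y'))))
    (hE : ∀ μ ν, BlockBd (g := toB6 g R₀ H₀) blkB blkS (E μ ν) (fun (y y' : g.Site) => CE * Real.exp (-(δK * g.dist y y'))))
    (hCp : ∀ μ, BlockBd (g := toB6 g R₀ H₀) blkS blkS (Cp μ) (fun (y y' : g.Site) => CC * Real.exp (-(δK * g.dist y y'))))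
    (hPr : ∀ ν, BlockBd (g := toB6 g R₀ H₀) blkS blkS (Pr ν) (fun (y y' : g.Site) => CQ * Real.exp (-(δK * g.dist y y'))))
    (hCA : 0 ≤ CA) (hCE : 0 ≤ CE) (hCC : 0 ≤ CC) (hCQ : 0 ≤ CQ) (hc : 0 ≤ c) (hρ : 0 ≤ ρ) (hρA : ρ ≤ δA) (hρK : ρ + σ ≤ δK)
    (hBd : |s| * ((Fintype.card P : ℝ) * (CQ * ((Fintype.card P : ℝ) * (CC * (CA * CE * c) * c)) * c)) ≤ Bd) :
    BlockBd (g := toB6 g R₀ H₀) blkB blkS T (fun (y y' : g.Site) => Bd * Real.exp (-(ρ * g.dist y y'))) := by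
  -- A μ ν ∘ E μ ν : the analytic factor at rate δ_A ≥ ρ, the kinematic one at δ_K ≥ ρ + σ
  have h1 : ∀ μ ν, BlockBd (g := toB6 g R₀ H₀) blkB blkS (A μ ν ∘ₗ E μ ν) (fun (y y' : g.Site) => CA * CE * c * Real.exp (-(ρ * g.dist y y'))) :=
    fun μ ν => blockBd_comp_exp_mirror hG hrow hCA hCE hρ hρA hρK (hA μ ν) (hE μ ν)
  have hK1 : 0 ≤ CA * CE * c := mul_nonneg (mul_nonneg hCA hCE) hc
  -- Cp μ ∘ (A μ ν ∘ E μ ν)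
  have h2 : ∀ μ ν, BlockBd (g := toB6 g R₀ H₀) blkB blkS (Cp μ ∘ₗ (A μ ν ∘ₗ E μ ν))
      (fun (y y' : g.Site) => CC * (CA * CE * c) * c * Real.exp (-(ρ * g.dist y y'))) :=
    fun μ ν => blockBd_comp_exp hG hrow hCC hK1 hρ le_rfl hρK (hCp μ) (h1 μ ν)
  -- Σ_μ
  have h3 : ∀ ν, BlockBd (g := toB6 g R₀ H₀) blkB blkS (∑ μ, Cp μ ∘ₗ (A μ ν ∘ₗ E μ ν))
      (fun (y y' : g.Site) => (Fintype.card P : ℝ) * (CC * (CA * CE * c) * c) * Real.exp (-(ρ * g.dist y y'))) :=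
    fun ν => (blockBd_fsum_const (fun μ => Cp μ ∘ₗ (A μ ν ∘ₗ E μ ν)) _ fun μ => h2 μ ν).mono fun y y' => le_of_eq (by ring)
  have hK3 : 0 ≤ (Fintype.card P : ℝ) * (CC * (CA * CE * c) * c) := by positivity
  -- Pr ν ∘ Σ_μ …
  have h4 : ∀ ν, BlockBd (g := toB6 g R₀ H₀) blkB blkS (Pr ν ∘ₗ ∑ μ, Cp μ ∘ₗ (A μ ν ∘ₗ E μ ν))
      (fun (y y' : g.Site) => CQ * ((Fintype.card P : ℝ) * (CC * (CA * CE * c) * c)) * c * Real.exp (-(ρ * g.dist y y'))) :=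
    fun ν => blockBd_comp_exp hG hrow hCQ hK3 hρ le_rfl hρK (hPr ν) (h3 ν)
  -- Σ_ν and the scalar
  have h5 : BlockBd (g := toB6 g R₀ H₀) blkB blkS (∑ ν, Pr ν ∘ₗ ∑ μ, Cp μ ∘ₗ (A μ ν ∘ₗ E μ ν))
      (fun (y y' : g.Site) => (Fintype.card P : ℝ) * (CQ * ((Fintype.card P : ℝ) * (CC * (CA * CE * c) * c)) * c) * Real.exp (-(ρ * g.dist y y'))) :=
    (blockBd_fsum_const (fun ν => Pr ν ∘ₗ ∑ μ, Cp μ ∘ₗ (A μ ν ∘ₗ E μ ν)) _ h4).mono fun y y' => le_of_eq (by ring)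
  have h6 := blockBd_smul_abs h5 s
  rw [hT]
  refine h6.mono fun y y' => ?_
  show |s| * ((Fintype.card P : ℝ) * (CQ * ((Fintype.card P : ℝ) * (CC * (CA * CE * c) * c)) * c) * Real.exp (-(ρ * g.dist y y'))) ≤
    Bd * Real.exp (-(ρ * g.dist y y'))
  rw [← mul_assoc]
  exact mul_le_mul_of_nonneg_right hBd (Real.exp_nonneg _)

/-! ## §2 The R∇\*_UG₁E letters from (3.152), (3.49) and a block-L² line of G′D\*E -/

omit [Fintype X] in
/-- ★★ **‖1_{Δ(y)}R∇\*_UG₁E‖ IN BLOCK L² FROM (3.152)** (`Letters313L2Pk.rgdDs` at E = ∇\*_U, `Letters313L2MZ.rgdDd μ₀` at E = ∇\*_{U,μ₀}): by (3.152)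
`RD\*G₁ = RG′D\*` (`Ids3152.rd`) and R = ϱ•(I − P): R∇\*_UG₁E = ϱ•(G′D\*E − P(G′D\*E)); a block-L² line ‖1_ΔG′D\*E‖ ≦ B₅e^{−δ₅d} (`hX`), (3.49) for P
(`blockBd_P`, rate δ_P, constant C_P, one composition at margin σ with `RowSum σ c`) give ‖1_{Δ(y)}R∇\*_UG₁Eλ‖₂ ≦ B₄e^{−δ₄d(y,y′)}‖λ‖₂ for
`0 ≤ δ₄ ≤ δ₅`, `δ₄ + σ ≤ δ_P`, any `B₄ ≥ ϱ·B₅·(1 + C_P c)` (`ϱ ≥ 0`).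
[cite: Balaban1985BackgroundPropagators, Thm 3.13 p.426, (3.152)–(3.153) p.426, Thm 3.1 (3.46) p.398, (3.49) p.399; Balaban1984PropagatorsII, (2.51)–(2.56) pp.232–233] -/
theorem rgdE_of_ids3152 (hG : GeoOK g) {σ c : ℝ} (hrow : RowSum (toB6 g R₀ H₀) σ c) {𝔬 : Ops g B X Y Z W} {Gp P : B.Cfg → Module.End ℝ (W → ℝ)}
    {U : B.Cfg} {V : Type} [Fintype V] {blkV : V → g.Site} {E : (V → ℝ) →ₗ[ℝ] (X → ℝ)} {CP δP ϱ B₅ δ₅ B₄ δ₄ : ℝ}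
    (h49 : Proj349Maj 𝔬.blkW 𝔬.blk (P U) (𝔬.Dv U) (𝔬.Dvstar U) R₀ H₀ CP δP)
    (hR : 𝔬.R U = ϱ • (LinearMap.id - P U)) (h152 : Ids3152 𝔬 Gp U) (hPT : IsTransposePair (P U) (P U))
    (hX : BlockBd (g := toB6 g R₀ H₀) blkV 𝔬.blkW (Gp U ∘ₗ 𝔬.Dvstar U ∘ₗ E) (fun (y y' : g.Site) => B₅ * Real.exp (-(δ₅ * g.dist y y'))))
    (hϱ : 0 ≤ ϱ) (hCP : 0 ≤ CP) (hB₅ : 0 ≤ B₅) (hδ₄ : 0 ≤ δ₄) (hδ₄5 : δ₄ ≤ δ₅) (hδ₄P : δ₄ + σ ≤ δP)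
    (hB₄ : ϱ * (B₅ * (1 + CP * c)) ≤ B₄) :
    BlockBd (g := toB6 g R₀ H₀) blkV 𝔬.blkW (𝔬.R U ∘ₗ 𝔬.Dvstar U ∘ₗ 𝔬.G1 U ∘ₗ E) (fun (y y' : g.Site) => B₄ * Real.exp (-(δ₄ * g.dist y y'))) := by
  -- (3.49) for P in block L²
  have hP := blockBd_P (X := X) hG h49 hCP hPT
  -- P ∘ (G′D*E): one composition at the margin σ
  have hcomp : BlockBd (g := toB6 g R₀ H₀) blkV 𝔬.blkW (P U ∘ₗ (Gp U ∘ₗ 𝔬.Dvstar U ∘ₗ E))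
      (fun (y y' : g.Site) => CP * B₅ * c * Real.exp (-(δ₄ * g.dist y y'))) :=
    blockBd_comp_exp hG hrow hCP hB₅ hδ₄ hδ₄5 hδ₄P hP hX
  -- G′D*E itself at the rate δ₄
  have hX' : BlockBd (g := toB6 g R₀ H₀) blkV 𝔬.blkW (Gp U ∘ₗ 𝔬.Dvstar U ∘ₗ E) (fun (y y' : g.Site) => B₅ * Real.exp (-(δ₄ * g.dist y y'))) :=
    hX.mono fun y y' => kernel_le_of_le hB₅ le_rfl hδ₄5 (hG.dnn y y')
  -- ϱ • (G′D*E − P G′D*E)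
  have hsub := blockBd_smul_abs (blockBd_sub hX' hcomp) ϱ
  -- the word: R D* G₁ E = R G′ D* E = ϱ • (G′D*E − P G′D*E)
  have hword : 𝔬.R U ∘ₗ 𝔬.Dvstar U ∘ₗ 𝔬.G1 U ∘ₗ E = ϱ • ((Gp U ∘ₗ 𝔬.Dvstar U ∘ₗ E) - P U ∘ₗ (Gp U ∘ₗ 𝔬.Dvstar U ∘ₗ E)) := by
    apply LinearMap.ext
    intro f
    have e := h152.rd_apply (E f)
    simp only [LinearMap.comp_apply, LinearMap.id_apply] at e
    simp only [LinearMap.comp_apply, LinearMap.smul_apply, LinearMap.sub_apply]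
    rw [e, hR]
    simp only [LinearMap.smul_apply, LinearMap.sub_apply, LinearMap.id_apply]
  rw [hword]
  refine hsub.mono fun y y' => ?_
  show |ϱ| * (B₅ * Real.exp (-(δ₄ * g.dist y y')) + CP * B₅ * c * Real.exp (-(δ₄ * g.dist y y'))) ≤ B₄ * Real.exp (-(δ₄ * g.dist y y'))
  rw [abs_of_nonneg hϱ]
  calc ϱ * (B₅ * Real.exp (-(δ₄ * g.dist y y')) + CP * B₅ * c * Real.exp (-(δ₄ * g.dist y y')))
      = ϱ * (B₅ * (1 + CP * c)) * Real.exp (-(δ₄ * g.dist y y')) := by ring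
    _ ≤ B₄ * Real.exp (-(δ₄ * g.dist y y')) := mul_le_mul_of_nonneg_right hB₄ (Real.exp_nonneg _)

end

end Literature.MathematicalPhysics.QuantumFieldTheory.Balaban1983to89.B9Thm313WholeRgdSecondFrom3152
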